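import Summits.BirchSwinnertonDyer.Rank1Residual.X11b.BDPRouteNonsingularPartIndex
import Summits.BirchSwinnertonDyer.Rank1Residual.X11b.BDPRouteLocalKernelInertiaBound
import Literature.NumberTheory.EllipticCurves.ReductionInertiaInvarianceProofs
import Literature.NumberTheory.EllipticCurves.ReductionHomomorphismCuspNodeProofs
import HarnessLib

/-!
# Class X11b, route p2: the subgroup `M₀` of points with non-singular reduction —
# divisibility of `M₀[p^∞]` from a LOCAL divisibility statement, and Greenberg's bound
# `#ker r_v ≤ c_v^{(p)}` modulo that statement (cell `b2b-bsdres`, sub-cell `multr1-p2`, gen 14)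

HONEST FRAMING (verbatim, cell `b2b-bsdres`): the goal of the cell is to DELETE the
COMBINATION-SHAPED residual classes for ALL analytic-rank `≤ 1` curves over `ℚ` — "full BSD
formula for every rank `≤ 1` curve in class `C`" assembled STRICTLY from published theorems — so
that the rank-`≤ 1` remainder becomes exactly the CONSTRUCTION-SHAPED classes, which are TYPED
(missing-input Props), NOT attempted; this is not "finishing BSD". Research route `p2` for class
X11b; no claim beyond the stated class; nothing booked; X11b stays CONSTRUCTION-SHAPED. Theorems
only; no definition, no named fact, no `sorry`. Continues `BDPRouteNonsingularPart(Index).lean`.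

## Content

* `map_inertia_eq_of_zsmul_eq_zero_of_reducesToNonsingular` — **inertia fixes the prime-to-`v`
  torsion of `E₀(K̄_v)`**: a point of `X(K̄_v)` with non-singular reduction killed by `n`, `|n|_v = 1`,
  is fixed by the local inertia group `I_𝔐` (inertia does not move reductions,
  `reducePoint_congrEquiv_map_eq`; reduction is injective on the prime-to-`p` torsion of `E₀`,
  `eq_of_reducePoint_eq_of_zsmul_eq_zero`; Silverman *AEC* VII.3.1).
* **`exists_nsmul_eq_of_mem_nonsingularPart_of_localDivisible`** — TRANSPORT: if every
  `I_𝔐`-fixed `p`-power-torsion point of `X(K̄_v)` with non-singular reduction is `p • Q'` for some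
  `Q'` with non-singular reduction (a purely LOCAL statement, `(LocDiv)`), then `M₀[p^∞]` is
  `p`-divisible (torsion points of `X(K̄_v)` come from `E(K̄)`, `exists_pointsMapOfEmb_eq_of_nsmul_eq_zero`;
  the preimage is `I_v`-fixed by the first bullet and Neukirch II (9.6), `exists_mem_inertia_apply_eq_holds`).
* **`natCard_localKer_le_pow_padicValNat_localTamagawaNumber_of_localDivisible`** — GREENBERG'S
  LEMMA 3.3 AT A BAD PLACE WITH THE TAMAGAWA BOUND, modulo `(LocDiv)`: for an elliptic curve `E`
  over a number field `K`, a `ℤ_p`-extension `κ`, and a finite place `v ∤ p` at which `(LocDiv)` holds,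
  `ker r_v = localKer (ker κ) E[p^∞] v` is finite and `#ker r_v ≤ p ^ ord_p c_v(E/K)`
  (assembly of `natCard_localKer_kerSubgroup_le_of_divisible`, `finiteIndex_nonsingularPart`,
  `inertiaSubOne_mem_nonsingularPart`, `relIndex_nonsingularPart_ker_dvd_localTamagawaNumber`,
  `finite_setOf_smul_decomp_eq_of_isPrimary`). `(LocDiv)` is proved by reduction type in the
  companion file `BDPRouteNonsingularTorsionDivisible.lean`.

CONDITIONAL use only; nothing booked; reach and labels unchanged.

References: [GreenbergLNM1716] §3 Lemma 3.3 (p. 87), §4 proof of Thm. 4.1 (p. 74: "`ker r_v` has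
order `c_v^{(p)}`"); [SilvermanAEC2009] VII.§2, Prop. VII.3.1, §VII.6; [NeukirchANT1999] II §9 (9.6).
-/

noncomputable section

open scoped Classical NNReal

open NumberField IsDedekindDomain Field IsDedekindDomain.HeightOneSpectrum WeierstrassCurve
open Literature.NumberTheory.EllipticCurves Literature.NumberTheory.EllipticCurves.GreenbergSelmer
open Literature.NumberTheory.GaloisRepresentations

universe u

namespace Summit.BirchSwinnertonDyer.Rank1Residual.X11b.AcSelmer

variable {K : Type u} [Field K] [NumberField K] {W : WeierstrassCurve K} {v : HeightOneSpectrum (𝓞 K)}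
  {w : Valuation (AlgebraicClosure (v.adicCompletion K)) ℝ≥0}
  (hw : ∀ x, (w x : ℝ) =
    spectralNorm (v.adicCompletion K) (AlgebraicClosure (v.adicCompletion K)) x)
  {W₀ : WeierstrassCurve w.integer}
  (hW₀ : ((W.localMinimalIntegralModel v).map (algebraMap (v.adicCompletionIntegers K)
      (v.adicCompletion K))).baseChange (AlgebraicClosure (v.adicCompletion K)) =
    W₀.baseChange (AlgebraicClosure (v.adicCompletion K)))

/-! ## Inertia fixes the prime-to-`v` torsion of `E₀(K̄_v)` -/

section InertiaTorsion

include hw hW₀ in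
/-- **Inertia fixes the prime-to-`v` torsion points with non-singular reduction.** Let `Q'` be a
point of `X(K̄_v)` (`X` the minimal model at `v`) with non-singular reduction for `|·|_v`, killed by an
integer `n` with `|n|_v = 1`, and `σ ∈ I_𝔐` (local inertia). Then `σ • Q' = Q'`: `σ` is an isometry
moving integers within their residue classes, so `σ • Q'` and `Q'` have the same reduction
(`reducePoint_congrEquiv_map_eq`), both lie in `E₀` and are killed by `n`, and reduction is injective
on the prime-to-`p` torsion of `E₀` (`eq_of_reducePoint_eq_of_zsmul_eq_zero`, Silverman VII.3.1).
[cite: SilvermanAEC2009, Prop. VII.3.1 (b) and VII.§2 Prop. 2.1] -/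
theorem map_inertia_eq_of_zsmul_eq_zero_of_reducesToNonsingular
    {𝔐 : Ideal v.localAbsIntegers} (h𝔐 : 𝔐 ∈ v.localPrimesAbove)
    {Q' : (((W.localMinimalIntegralModel v).map (algebraMap (v.adicCompletionIntegers K)
      (v.adicCompletion K))).baseChange (AlgebraicClosure (v.adicCompletion K))).toAffine.Point}
    (hQ' : ReducesToNonsingular w (IsLocalRing.residue w.integer) Q') {n : ℤ}
    (hn : w (n : AlgebraicClosure (v.adicCompletion K)) = 1) (hnQ : n • Q' = 0)
    {σ : absoluteGaloisGroup (v.adicCompletion K)}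
    (hσ : σ ∈ 𝔐.inertia (absoluteGaloisGroup (v.adicCompletion K))) :
    Affine.Point.map ((absoluteGaloisGroup.toAlgEquiv _ σ :
        AlgebraicClosure (v.adicCompletion K) ≃ₐ[v.adicCompletion K]
          AlgebraicClosure (v.adicCompletion K)) :
        AlgebraicClosure (v.adicCompletion K) →ₐ[v.adicCompletion K]
          AlgebraicClosure (v.adicCompletion K)) Q' = Q' := by
  obtain ⟨hσ₁, hσ₂⟩ := isometry_of_mem_inertia hw h𝔐 hσ
  -- transport to `W₀`
  have hQ'₀ : W₀.HasNonsingularReduction (Affine.Point.congrEquiv hW₀ Q') :=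
    (reducesToNonsingular_iff_hasNonsingularReduction W₀ _).mp
      ((reducesToNonsingular_congrEquiv_iff _ hW₀ Q').mpr hQ')
  have hσQ'₀ : W₀.HasNonsingularReduction (Affine.Point.congrEquiv hW₀
      (Affine.Point.map ((absoluteGaloisGroup.toAlgEquiv _ σ :
        AlgebraicClosure (v.adicCompletion K) ≃ₐ[v.adicCompletion K]
          AlgebraicClosure (v.adicCompletion K)) :
        AlgebraicClosure (v.adicCompletion K) →ₐ[v.adicCompletion K]
          AlgebraicClosure (v.adicCompletion K)) Q')) :=
    (W₀.hasNonsingularReduction_congrEquiv_map_iff hW₀ _ hσ₁ hσ₂ Q').mpr hQ'₀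
  have hred := W₀.reducePoint_congrEquiv_map_eq hW₀
    ((absoluteGaloisGroup.toAlgEquiv _ σ :
        AlgebraicClosure (v.adicCompletion K) ≃ₐ[v.adicCompletion K]
          AlgebraicClosure (v.adicCompletion K)) :
        AlgebraicClosure (v.adicCompletion K) →ₐ[v.adicCompletion K]
          AlgebraicClosure (v.adicCompletion K)) hσ₁ hσ₂ Q'
  have h := W₀.eq_of_reducePoint_eq_of_zsmul_eq_zero hn hσQ'₀ hQ'₀
    (by rw [← map_zsmul, ← map_zsmul, hnQ, map_zero, map_zero])
    (by rw [← map_zsmul, hnQ, map_zero]) hred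
  exact (Affine.Point.congrEquiv hW₀).injective h

end InertiaTorsion

/-! ## Transport of the local divisibility to `M₀[p^∞]` -/

section Transport

variable {Φ : localPoints W (v.adicCompletion K) ≃+
    (((W.localMinimalIntegralModel v).map (algebraMap (v.adicCompletionIntegers K)
      (v.adicCompletion K))).baseChange (AlgebraicClosure (v.adicCompletion K))).toAffine.Point}
  (hΦ : ∀ (σ : absoluteGaloisGroup (v.adicCompletion K)) (Q : localPoints W (v.adicCompletion K)),
    Φ (σ • Q) = Affine.Point.map ((absoluteGaloisGroup.toAlgEquiv _ σ :
        AlgebraicClosure (v.adicCompletion K) ≃ₐ[v.adicCompletion K]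
          AlgebraicClosure (v.adicCompletion K)) :
        AlgebraicClosure (v.adicCompletion K) →ₐ[v.adicCompletion K]
          AlgebraicClosure (v.adicCompletion K)) (Φ Q))

include hw hΦ in
/-- **`M₀[p^∞]` is `p`-divisible, from the LOCAL divisibility `(LocDiv)`.** Suppose that at a prime
`𝔐` of `\bar 𝓞_v` above `𝓂_v` every `I_𝔐`-fixed point of `X(K̄_v)` with non-singular reduction and
`p`-power order is `p • Q'` for some `Q'` with non-singular reduction, and that `p` is a unit at `v`.
Then every `b ∈ M₀` of `p`-power order is `p • b'` for some `b' ∈ M₀` of `p`-power order: `Q'` has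
`p`-power order, hence is `I_𝔐`-fixed (first lemma) and of the form `Φ (ι_* P')` for a torsion point
`P' ∈ E(K̄)` (`exists_pointsMapOfEmb_eq_of_nsmul_eq_zero`); `P'` is `I_v`-fixed because every element of
`I_v = I_{𝔓_{ι,𝔐}}` is the restriction of an element of `I_𝔐` (Neukirch II (9.6),
`exists_mem_inertia_apply_eq_holds`). [cite: NeukirchANT1999, Ch. II §9 Prop. (9.6)]
[cite: SilvermanAEC2009, Cor. III.6.4 (torsion is algebraic) and Prop. VII.3.1] -/
theorem exists_nsmul_eq_of_mem_nonsingularPart_of_localDivisible [W.IsElliptic]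
    {𝔐 : Ideal v.localAbsIntegers} (h𝔐 : 𝔐 ∈ v.localPrimesAbove) {p : ℕ} [Fact p.Prime]
    (hp : IsUnit ((p : ℕ) : v.adicCompletionIntegers K))
    (hLoc : ∀ Q : (((W.localMinimalIntegralModel v).map (algebraMap (v.adicCompletionIntegers K)
        (v.adicCompletion K))).baseChange (AlgebraicClosure (v.adicCompletion K))).toAffine.Point,
      (∀ σ ∈ 𝔐.inertia (absoluteGaloisGroup (v.adicCompletion K)),
        Affine.Point.map ((absoluteGaloisGroup.toAlgEquiv _ σ :
            AlgebraicClosure (v.adicCompletion K) ≃ₐ[v.adicCompletion K]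
              AlgebraicClosure (v.adicCompletion K)) :
            AlgebraicClosure (v.adicCompletion K) →ₐ[v.adicCompletion K]
              AlgebraicClosure (v.adicCompletion K)) Q = Q) →
      ReducesToNonsingular w (IsLocalRing.residue w.integer) Q →
      (∃ k : ℕ, p ^ k • Q = 0) →
        ∃ Q', ReducesToNonsingular w (IsLocalRing.residue w.integer) Q' ∧ p • Q' = Q) :
    ∀ b ∈ AddCommGroup.primaryComponent
        ↥(FixedPoints.addSubgroup ↥((adicCompletionPrime K v).inertia (absoluteGaloisGroup K))
          W.geomPoints) p, b ∈ nonsingularPart W hW₀ Φ →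
      ∃ b' ∈ AddCommGroup.primaryComponent
          ↥(FixedPoints.addSubgroup ↥((adicCompletionPrime K v).inertia (absoluteGaloisGroup K))
            W.geomPoints) p, b' ∈ nonsingularPart W hW₀ Φ ∧ p • b' = b := by
  have hpp : (p : ℕ).Prime := Fact.out
  let ι := closureEmb (K := K) (v.adicCompletion K)
  intro b hb hbM₀
  obtain ⟨k, hk⟩ := (AddCommGroup.mem_primaryComponent).mp hb
  -- the local point `Q = F b` and its `p`-th root `Q'`
  set Q := Φ (pointsMapOfEmb W ι ((b : FixedPoints.addSubgroup
    ↥((adicCompletionPrime K v).inertia (absoluteGaloisGroup K)) W.geomPoints) : W.geomPoints))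
    with hQdef
  have hQfix : ∀ σ ∈ 𝔐.inertia (absoluteGaloisGroup (v.adicCompletion K)),
      Affine.Point.map ((absoluteGaloisGroup.toAlgEquiv _ σ :
          AlgebraicClosure (v.adicCompletion K) ≃ₐ[v.adicCompletion K]
            AlgebraicClosure (v.adicCompletion K)) :
          AlgebraicClosure (v.adicCompletion K) →ₐ[v.adicCompletion K]
            AlgebraicClosure (v.adicCompletion K)) Q = Q :=
    fun σ hσ ↦ map_inertia_transport_eq hΦ h𝔐 b hσ
  have hQE₀ : ReducesToNonsingular w (IsLocalRing.residue w.integer) Q :=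
    (mem_nonsingularPart_iff_reducesToNonsingular _).mp hbM₀
  have hQk : p ^ k • Q = 0 := by
    rw [hQdef, ← map_nsmul, ← map_nsmul, ← AddSubgroupClass.coe_nsmul, hk, ZeroMemClass.coe_zero,
      map_zero, map_zero]
  obtain ⟨Q', hQ'E₀, hpQ'⟩ := hLoc Q hQfix hQE₀ ⟨k, hQk⟩
  -- `Q'` has `p`-power order, hence is `I_𝔐`-fixed and comes from `E(K̄)`
  have hQ'k : p ^ (k + 1) • Q' = 0 := by rw [pow_succ, mul_smul, hpQ', hQk]
  have hwp : w ((((p : ℕ) ^ (k + 1) : ℕ) : ℤ) : AlgebraicClosure (v.adicCompletion K)) = 1 := by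
    rw [Int.cast_natCast, Nat.cast_pow, map_pow, spectralValuation_natCast_eq_one_of_isUnit hw hp,
      one_pow]
  have hQ'fix : ∀ σ ∈ 𝔐.inertia (absoluteGaloisGroup (v.adicCompletion K)),
      Affine.Point.map ((absoluteGaloisGroup.toAlgEquiv _ σ :
          AlgebraicClosure (v.adicCompletion K) ≃ₐ[v.adicCompletion K]
            AlgebraicClosure (v.adicCompletion K)) :
          AlgebraicClosure (v.adicCompletion K) →ₐ[v.adicCompletion K]
            AlgebraicClosure (v.adicCompletion K)) Q' = Q' :=
    fun σ hσ ↦ map_inertia_eq_of_zsmul_eq_zero_of_reducesToNonsingular hw hW₀ h𝔐 hQ'E₀ hwp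
      (by rw [natCast_zsmul, hQ'k]) hσ
  obtain ⟨P', hP'k, hP'⟩ := exists_pointsMapOfEmb_eq_of_nsmul_eq_zero W ι
    (pow_ne_zero (k + 1) hpp.ne_zero) (Q := Φ.symm Q')
    (by rw [← map_nsmul, hQ'k, map_zero])
  have hΦP' : Φ (pointsMapOfEmb W ι P') = Q' := by rw [hP', AddEquiv.apply_symm_apply]
  -- `P'` is `I_v`-fixed
  have hP'fix : ∀ i : ↥((adicCompletionPrime K v).inertia (absoluteGaloisGroup K)),
      i • P' = P' := by
    intro i
    have hi : (i : absoluteGaloisGroup K) ∈ (v.primeBelow ι 𝔐).inertia (absoluteGaloisGroup K) := by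
      rw [primeBelow_closureEmb_eq_adicCompletionPrime v h𝔐]; exact i.2
    obtain ⟨σ, hσI, hσ⟩ := v.exists_mem_inertia_apply_eq_holds ι h𝔐 hi
    -- `i = res_ι σ`
    have hinjι : Function.Injective ι := ι.toRingHom.injective
    have hiσ : (i : absoluteGaloisGroup K) = resGalOfEmb ι σ := by
      apply AlgEquiv.ext
      intro x
      apply hinjι
      change ι ((i : absoluteGaloisGroup K) • x) =
        ι ((show AlgebraicClosure K ≃ₐ[K] AlgebraicClosure K from resGalAuxOfEmb ι σ) x)
      rw [hσ x, apply_resGalAuxOfEmb_apply]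
      rfl
    apply pointsMapOfEmb_injective W ι
    apply Φ.injective
    change Φ (pointsMapOfEmb W ι ((i : absoluteGaloisGroup K) • P')) = Φ (pointsMapOfEmb W ι P')
    rw [hiσ, transport_pointsMapOfEmb_smul hΦ, hΦP']
    exact hQ'fix σ hσI
  refine ⟨⟨P', hP'fix⟩, (AddCommGroup.mem_primaryComponent).mpr ⟨k + 1, Subtype.ext ?_⟩, ?_, ?_⟩
  · rw [AddSubgroupClass.coe_nsmul, ZeroMemClass.coe_zero]; exact hP'k
  · rw [mem_nonsingularPart_iff_reducesToNonsingular]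
    change ReducesToNonsingular w (IsLocalRing.residue w.integer) (Φ (pointsMapOfEmb W ι P'))
    rw [hΦP']; exact hQ'E₀
  · apply Subtype.ext
    apply pointsMapOfEmb_injective W ι
    apply Φ.injective
    change Φ (pointsMapOfEmb W ι (p • P')) = Q
    rw [map_nsmul, map_nsmul, hΦP', hpQ']

end Transport

/-! ## Greenberg's Lemma 3.3 with the Tamagawa bound, modulo the local divisibility -/

section Bound

/-- **`#ker r_v ≤ c_v^{(p)}` at a place `v ∤ p`, modulo the local divisibility `(LocDiv)`.** For an
elliptic curve `E` over a number field `K`, a prime `p`, a `ℤ_p`-extension `κ` (`K_∞ = K̄^{ker κ}`) and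
a finite place `v ∤ p`: if at `v` every inertia-fixed point of the minimal model over `K̄_v` with
non-singular reduction and `p`-power order is `p`-divisible by a point with non-singular reduction
(`(LocDiv)`, for the spectral valuation and any prime of `\bar 𝓞_v` above `𝓂_v`), then Greenberg's
local kernel `ker r_v = ker (H¹(K_v, E[p^∞]) → H¹(K_{∞,w}, E[p^∞]))` is finite and
`#ker r_v ≤ p ^ ord_p c_v(E/K)` (LNM 1716, Lemma 3.3 and proof of Thm. 4.1: "`ker r_v` has order
`c_v^{(p)}`"; here the inequality). Assembly: `ker r_v ↪ E[p^∞]^{I_v}/(φ−1)` (inertia route),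
the Tamagawa algebra with `M₀ = nonsingularPart` (`D_v`-stable, finite index by Kodaira–Néron,
`M₀[p^∞]` divisible by `(LocDiv)`, `[E(K̄)^{D_v} : E(K̄)^{D_v} ⊓ M₀] ∣ c_v`), finiteness of
`E(K_v)[p^∞]`. [cite: GreenbergLNM1716, §3 Lemma 3.3 (p. 87) and §4 proof of Thm. 4.1 (p. 74)]
[cite: SilvermanAEC2009, Thm. VII.6.1 / Cor. VII.6.2 and §VII.6 Ex. 7.6] -/
theorem natCard_localKer_le_pow_padicValNat_localTamagawaNumber_of_localDivisible
    (W : WeierstrassCurve K) [W.IsElliptic] {p : ℕ} [Fact p.Prime] (κ : ZpExtension K p)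
    {v : HeightOneSpectrum (𝓞 K)} (hpv : (p : 𝓞 K) ∉ v.asIdeal)
    (hLoc : ∀ (w : Valuation (AlgebraicClosure (v.adicCompletion K)) ℝ≥0)
      (_hw : ∀ x, (w x : ℝ) =
        spectralNorm (v.adicCompletion K) (AlgebraicClosure (v.adicCompletion K)) x)
      (𝔐 : Ideal v.localAbsIntegers) (_h𝔐 : 𝔐 ∈ v.localPrimesAbove)
      (Q : (((W.localMinimalIntegralModel v).map (algebraMap (v.adicCompletionIntegers K)
        (v.adicCompletion K))).baseChange (AlgebraicClosure (v.adicCompletion K))).toAffine.Point),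
      (∀ σ ∈ 𝔐.inertia (absoluteGaloisGroup (v.adicCompletion K)),
        Affine.Point.map ((absoluteGaloisGroup.toAlgEquiv _ σ :
            AlgebraicClosure (v.adicCompletion K) ≃ₐ[v.adicCompletion K]
              AlgebraicClosure (v.adicCompletion K)) :
            AlgebraicClosure (v.adicCompletion K) →ₐ[v.adicCompletion K]
              AlgebraicClosure (v.adicCompletion K)) Q = Q) →
      ReducesToNonsingular w (IsLocalRing.residue w.integer) Q →
      (∃ k : ℕ, p ^ k • Q = 0) →
        ∃ Q', ReducesToNonsingular w (IsLocalRing.residue w.integer) Q' ∧ p • Q' = Q) :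
    Finite (localKer κ.kerSubgroup (W.geomPrimaryTorsion p) v) ∧
      Nat.card (localKer κ.kerSubgroup (W.geomPrimaryTorsion p) v) ≤
        p ^ padicValNat p
          ((W.baseChange (v.adicCompletion K)).localTamagawaNumber (v.adicCompletionIntegers K)) := by
  have hpp : (p : ℕ).Prime := Fact.out
  -- local data
  obtain ⟨w, hw⟩ := v.exists_spectralValuation
  obtain ⟨𝔐, h𝔐⟩ := v.localPrimesAbove_nonempty
  have hint := WeierstrassCurve.isIntegral_spectralValuation_baseChange hw
    (W.localMinimalIntegralModel v)
  obtain ⟨W₀, hW₀⟩ := hint.integral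
  obtain ⟨C, hC⟩ := W.exists_variableChange_eq_localMinimalIntegralModel v
  obtain ⟨Φ, hΦ⟩ := W.exists_addEquiv_localPoints_of_smul_eq v hC
  have hp : IsUnit ((p : ℕ) : v.adicCompletionIntegers K) := by
    have h := isUnit_algebraMap_adicCompletionIntegers K v hpv
    rwa [map_natCast] at h
  -- a Frobenius at `𝔓₀`
  obtain ⟨φ, hφ⟩ := exists_isArithFrobAt_of_mem_primesAbove_holds
    (adicCompletionPrime_mem_primesAbove K v)
  have hφD : φ ∈ decomp v :=
    (decomp_eq_decompositionSubgroup_adicCompletionPrime v).symm ▸ hφ.mem_stabilizer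
  -- the subgroup `M₀` and its properties
  haveI := finiteIndex_nonsingularPart hw hW₀ hΦ
  obtain ⟨hfin, hle⟩ := natCard_localKer_kerSubgroup_le_of_divisible W κ hpv hφ hφD
    (nonsingularPart W hW₀ Φ) (fun x hx ↦ inertiaSubOne_mem_nonsingularPart hw hW₀ hΦ hφD hx)
    (exists_nsmul_eq_of_mem_nonsingularPart_of_localDivisible hw hW₀ hΦ h𝔐 hp (hLoc w hw 𝔐 h𝔐))
    (finite_setOf_smul_decomp_eq_of_isPrimary W p hpv)
  refine ⟨hfin, hle.trans (Nat.pow_le_pow_right hpp.pos ?_)⟩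
  -- `ord_p [E(K̄)^{D_v} : E(K̄)^{D_v} ⊓ M₀] ≤ ord_p c_v`
  have hdvd := relIndex_nonsingularPart_ker_dvd_localTamagawaNumber hw hW₀ hΦ hφ hφD
  have hcv : (W.baseChange (v.adicCompletion K)).localTamagawaNumber (v.adicCompletionIntegers K) ≠ 0 :=
    W.localTamagawaNumber_baseChange_ne_zero v
  exact (padicValNat_dvd_iff_le hcv).mp (pow_padicValNat_dvd.trans hdvd)

end Bound

end Summit.BirchSwinnertonDyer.Rank1Residual.X11b.AcSelmer

end
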